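import Literature.Probability.Percolation.TriPathCrossings
import Literature.Probability.Percolation.TriShiftedCrossings
import Literature.Probability.Percolation.SiteSharpnessStep
import Literature.Probability.Percolation.SiteBK
import HarnessLib

/-!
# The block argument for easy-way crossings of `𝕋`: `P(LR(2a+1, 4a+2)) ≤ 100 · P(LR(a, 2a))²`

Topic `Literature/Probability/Percolation`; family `crit-perc`. The "block argument" of Nolin 2008,
§7.4, proof of Lemma 39 [arXiv 0711.4948: Lemma 37], eq. (7.21):
"`P_p(𝒞_H([0, 2n] × [0, 4n])) ≤ C' [P_p(𝒞_H([0, n] × [0, 2n]))]²` with `C' = 10²` some universal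
constant. It suffices for that (…) to divide the parallelogram `[0, 2n] × [0, 4n]` into 4
horizontal sub-parallelograms `[0, 2n] × [in, (i+1)n]` (`i = 0, …, 3`) and 6 vertical ones
`[in, (i+1)n] × [jn, (j+2)n]` (`i = 0, 1`, `j = 0, 1, 2`). Indeed, consider a horizontal crossing
of the big parallelogram: by considering its pieces in the two regions `0 < x < n` and
`n < x < 2n`, we can extract from it two sub-paths crossing one of the sub-parallelograms 'in the
easy way'. They are disjoint by construction, so the claim follows by using the BK inequality."
— for SITE percolation on `𝕋`, in a lattice form adapted to iteration: the big parallelogram is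
`[0, 2a+1] × [0, 4a+2] = [0, a'] × [0, 2a']`, `a' = 2a + 1` (so that the shape `[0, a] × [0, 2a]`
reproduces itself), its two strips are `{0 ≤ x₀ ≤ a}` and `{a+1 ≤ x₀ ≤ 2a+1}` (width `a` each, site-
disjoint), the bands are `[ia, (i+1)a]` and the windows `[ja, (j+2)a]`, `i, j ∈ {0, …, 4}`
(`a ≥ 1`; the fifth band and window absorb the two extra rows of the lattice box), and the
constant stays Nolin's `C' = 10²` (10 block events per strip).

* `PathIn.band_or_window` — the deterministic dichotomy for one piece: a `𝕋`-path with sites at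
  heights in `[0, 4a+2]` either crosses some band `[ia, (i+1)a]` (`i ≤ 4`) from bottom to top, or
  stays inside some window `[ja, (j+2)a]` (`j ≤ 4`) (via the lowest and highest sites reachable
  from its start, `PathIn.exists_slab_crossing` and `PathIn.restrict`).
* `blockEventL`, `blockEventR` — the 10 + 10 translated easy-crossing events (bands: `TB(2a, a)`; windows:
  `LR(a, 2a)`; `TriShiftedCrossings.lean` format), each of probability `P_p(LR(a, 2a))`.
* `triLRCrossing_subset_iUnion_disjointOccurrence` — `LR(2a+1, 4a+2) ⊆ ⋃ E □ E'` over pairs of a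
  left and a right block event (disjoint occurrence `□` of `PercolationEvents.lean`, witnessed by
  the open sites of the two strips).
* `triLRCrossingProb_block_le` — **(7.21)**: `P_p(LR(2a+1, 4a+2)) ≤ 100 · P_p(LR(a, 2a))²`, by the
  union bound and the BK inequality for site percolation (`sitePercolation_bk`, `SiteBK.lean`).

## References

* P. Nolin, *Electron. J. Probab.* 13 (2008), §7.4, Lemma 39, eq. (7.21) (arXiv 0711.4948:
  Lemma 37) [Nolin2008].
* G. Grimmett, *Percolation*, 2nd ed. (1999), Thm. (2.12) (BK) [GrimmettPercolation1999].
-/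

noncomputable section

open MeasureTheory Set
open scoped Literature.Probability.LatticeModels Literature.Probability.Percolation unitInterval

namespace Literature.Probability.Percolation

open SimpleGraph

/-! ### One piece: band crossed or window kept -/

/-- **Band or window.** Let `a ≥ 1` and let `S` be a set of sites at heights in `[0, 4a + 2]`. A
`𝕋`-path with sites in `S` from `s` to `t` either yields a bottom-to-top crossing, inside `S`, of
some band `{ia ≤ x₁ ≤ (i+1)a}` with `i ≤ 4`, or can be re-routed inside `S` within some window
`{ja ≤ x₁ ≤ (j+2)a}` with `j ≤ 4` (consider the lowest and the highest sites reachable from `s`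
inside `S`; Nolin 2008, proof of Lemma 39: "we can extract from it two sub-paths crossing one of
the sub-parallelograms 'in the easy way'"). [cite: Nolin2008, §7.4, Lemma 39 (proof, eq. (7.21); arXiv 0711.4948: Lemma 37)] -/
theorem PathIn.band_or_window {S : Set (LatticeModels.Site 2)} {a : ℤ} (ha : 1 ≤ a)
    (hS : ∀ z ∈ S, 0 ≤ z 1 ∧ z 1 ≤ 4 * a + 2) {s t : LatticeModels.Site 2} (h : PathIn LatticeModels.triGraph S s t) :
    (∃ i : ℕ, i ≤ 4 ∧ ∃ u v : LatticeModels.Site 2, u 1 = i * a ∧ v 1 = i * a + a ∧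
        PathIn LatticeModels.triGraph (S ∩ {z | (i : ℤ) * a ≤ z 1 ∧ z 1 ≤ i * a + a}) u v) ∨
      ∃ j : ℕ, j ≤ 4 ∧ PathIn LatticeModels.triGraph (S ∩ {z | (j : ℤ) * a ≤ z 1 ∧ z 1 ≤ j * a + 2 * a}) s t := by
  classical
  -- the sites reachable from `s` inside `S`, and their lowest / highest heights
  set C : Set (LatticeModels.Site 2) := {z | PathIn LatticeModels.triGraph S s z} with hC
  have hsC : s ∈ C := PathIn.refl h.left_mem
  have hCS : ∀ z ∈ C, z ∈ S := fun z hz => PathIn.right_mem hz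
  -- lowest height, via `Nat.find` on `k ↦ ∃ z ∈ C, z 1 = k`
  have hex_lo : ∃ k : ℕ, ∃ z ∈ C, z 1 = k := ⟨(s 1).toNat, s, hsC, by
    rw [Int.toNat_of_nonneg (hS s h.left_mem).1]⟩
  set klo := Nat.find hex_lo with hklo
  obtain ⟨zlo, hzloC, hzlo⟩ := Nat.find_spec hex_lo
  have hlo_min : ∀ z ∈ C, zlo 1 ≤ z 1 := by
    intro z hz
    have h0 := (hS z (hCS z hz)).1
    have := Nat.find_min' hex_lo ⟨z, hz, (Int.toNat_of_nonneg h0).symm⟩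
    rw [hzlo]; omega
  -- highest height, via `Nat.find` on `k ↦ ∃ z ∈ C, z 1 = 4a + 2 - k`
  have hex_hi : ∃ k : ℕ, ∃ z ∈ C, z 1 = 4 * a + 2 - k := ⟨(4 * a + 2 - s 1).toNat, s, hsC, by
    rw [Int.toNat_of_nonneg (by linarith [(hS s h.left_mem).2])]; ring⟩
  obtain ⟨zhi, hzhiC, hzhi⟩ := Nat.find_spec hex_hi
  have hhi_max : ∀ z ∈ C, z 1 ≤ zhi 1 := by
    intro z hz
    have h1 := (hS z (hCS z hz)).2
    have := Nat.find_min' hex_hi ⟨z, hz, show z 1 = 4 * a + 2 - ((4 * a + 2 - z 1).toNat : ℕ) by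
      rw [Int.toNat_of_nonneg (by linarith)]; ring⟩
    rw [hzhi]; omega
  have hlo0 : 0 ≤ zlo 1 := (hS zlo (hCS zlo hzloC)).1
  have hhiH : zhi 1 ≤ 4 * a + 2 := (hS zhi (hCS zhi hzhiC)).2
  -- a path inside `S` from the lowest to the highest reachable site
  have hpath : PathIn LatticeModels.triGraph S zlo zhi := (PathIn.symm hzloC).trans hzhiC
  -- band index of the lowest site
  set i₁ : ℤ := zlo 1 / a with hi₁
  have ha0 : 0 < a := by linarith
  have hi₁0 : 0 ≤ i₁ := Int.ediv_nonneg hlo0 ha0.le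
  have hi₁lo : i₁ * a ≤ zlo 1 := Int.ediv_mul_le _ ha0.ne'
  have hi₁hi : zlo 1 < i₁ * a + a := by
    have := Int.lt_ediv_add_one_mul_self (zlo 1) ha0
    linarith [this]
  by_cases hband : ∃ i : ℕ, i ≤ 4 ∧ zlo 1 ≤ i * a ∧ (i : ℤ) * a + a ≤ zhi 1
  · -- some band is crossed
    obtain ⟨i, hi3, hilo, hihi⟩ := hband
    left
    obtain ⟨u, v, hu, hv, hq⟩ := hpath.exists_slab_crossing 1 (by linarith) hilo hihi
    exact ⟨i, hi3, u, v, hu, hv, hq⟩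
  · -- no band crossed: the reachable set lies in the window `j = min i₁ 4`
    right
    push Not at hband
    have hwin : ∀ z ∈ C, min i₁ 4 * a ≤ z 1 ∧ z 1 ≤ min i₁ 4 * a + 2 * a := by
      intro z hz
      have hzlo := hlo_min z hz
      have hzhi := hhi_max z hz
      rcases le_or_gt i₁ 3 with hi2 | hi2
      · -- band `i₁ + 1 ≤ 4` is not crossed
        have hmin : min i₁ 4 = i₁ := min_eq_left (by linarith)
        rw [hmin]
        have key := hband (i₁ + 1).toNat (by omega)
        have hcast : (((i₁ + 1).toNat : ℕ) : ℤ) = i₁ + 1 := Int.toNat_of_nonneg (by linarith)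
        rw [hcast] at key
        have : zhi 1 < (i₁ + 1) * a + a := key (by linarith)
        constructor
        · linarith
        · nlinarith
      · have hmin : min i₁ 4 = 4 := min_eq_right (by linarith)
        rw [hmin]
        constructor
        · nlinarith
        · linarith
    refine ⟨(min i₁ 4).toNat, by omega, ?_⟩
    have hcast : (((min i₁ 4).toNat : ℕ) : ℤ) = min i₁ 4 :=
      Int.toNat_of_nonneg (le_min hi₁0 (by norm_num))
    rw [hcast]
    exact h.restrict.mono fun z hz => ⟨hz.1, hwin z hz.2⟩

/-! ### The block events -/

/-- The 10 block events of the LEFT strip `{0 ≤ x₀ ≤ a}` of `[0, 2a+1] × [0, 4a+2]`: for `b = true`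
the band crossings — an open top–bottom crossing of `[0, 2a] × [ia, (i+1)a]` (`TB(2a, a)`
translated by `(0, ia)`); for `b = false` the window crossings — an open left–right crossing of
`[0, a] × [ja, (j+2)a]` (`LR(a, 2a)` translated by `(0, ja)`). All are translates of easy-way
crossings of an `a × 2a` parallelogram (Nolin 2008, proof of Lemma 39: the sub-parallelograms
`[0, 2n] × [in, (i+1)n]` and `[in, (i+1)n] × [jn, (j+2)n]`). [cite: Nolin2008, §7.4, Lemma 39 (proof, eq. (7.21); arXiv 0711.4948: Lemma 37)] -/
def blockEventL (a : ℕ) : Bool → Fin 5 → Set (SiteConfig (LatticeModels.Site 2))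
  | true, i => SiteConfig.relabel (triShiftIso (-![(0 : ℤ), ((i : ℕ) : ℤ) * a])).toEquiv ⁻¹'
      triTBCrossing (2 * a) a
  | false, j => SiteConfig.relabel (triShiftIso (-![(0 : ℤ), ((j : ℕ) : ℤ) * a])).toEquiv ⁻¹'
      triLRCrossing a (2 * a)

/-- The 10 block events of the RIGHT strip `{a+1 ≤ x₀ ≤ 2a+1}`: band crossings of
`[1, 2a+1] × [ia, (i+1)a]` and window crossings of `[a+1, 2a+1] × [ja, (j+2)a]`. [cite: Nolin2008, §7.4, Lemma 39 (proof, eq. (7.21); arXiv 0711.4948: Lemma 37)] -/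
def blockEventR (a : ℕ) : Bool → Fin 5 → Set (SiteConfig (LatticeModels.Site 2))
  | true, i => SiteConfig.relabel (triShiftIso (-![(1 : ℤ), ((i : ℕ) : ℤ) * a])).toEquiv ⁻¹'
      triTBCrossing (2 * a) a
  | false, j => SiteConfig.relabel (triShiftIso (-![((a : ℤ) + 1), ((j : ℕ) : ℤ) * a])).toEquiv ⁻¹'
      triLRCrossing a (2 * a)

/-- Block events are increasing. [folklore] -/
theorem isUpperSet_blockEventL (a : ℕ) (b : Bool) (i : Fin 5) : IsUpperSet (blockEventL a b i) := by
  cases b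
  · exact isUpperSet_shift_triLRCrossing _ _ _
  · exact isUpperSet_shift_triTBCrossing _ _ _

/-- Block events are increasing. [folklore] -/
theorem isUpperSet_blockEventR (a : ℕ) (b : Bool) (i : Fin 5) : IsUpperSet (blockEventR a b i) := by
  cases b
  · exact isUpperSet_shift_triLRCrossing _ _ _
  · exact isUpperSet_shift_triTBCrossing _ _ _

/-- Block events are local. [folklore] -/
theorem exists_determinedBy_blockEventL (a : ℕ) (b : Bool) (i : Fin 5) :
    ∃ F : Finset (LatticeModels.Site 2), DeterminedBy (blockEventL a b i) ↑F := by
  cases b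
  · exact ⟨_, determinedBy_shift_triLRCrossing _ _ _⟩
  · exact ⟨_, determinedBy_shift_triTBCrossing _ _ _⟩

/-- Block events are local. [folklore] -/
theorem exists_determinedBy_blockEventR (a : ℕ) (b : Bool) (i : Fin 5) :
    ∃ F : Finset (LatticeModels.Site 2), DeterminedBy (blockEventR a b i) ↑F := by
  cases b
  · exact ⟨_, determinedBy_shift_triLRCrossing _ _ _⟩
  · exact ⟨_, determinedBy_shift_triTBCrossing _ _ _⟩

/-- Each block event has the probability of an easy-way crossing of `[0, a] × [0, 2a]`. [folklore] -/
theorem real_blockEventL (p : unitInterval) (a : ℕ) (b : Bool) (i : Fin 5) :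
    (LatticeModels.triSitePercolation p).real (blockEventL a b i) = triLRCrossingProb p a (2 * a) := by
  cases b
  · exact real_shift_triLRCrossing p _ _ _
  · exact real_shift_triTBCrossing p _ _ _

/-- Each block event has the probability of an easy-way crossing of `[0, a] × [0, 2a]`. [folklore] -/
theorem real_blockEventR (p : unitInterval) (a : ℕ) (b : Bool) (i : Fin 5) :
    (LatticeModels.triSitePercolation p).real (blockEventR a b i) = triLRCrossingProb p a (2 * a) := by
  cases b
  · exact real_shift_triLRCrossing p _ _ _
  · exact real_shift_triTBCrossing p _ _ _

/-! ### A crossing of the big parallelogram forces two disjoint block crossings -/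

/-- **Two disjoint block crossings** (Nolin 2008, proof of Lemma 39, (7.21)): every configuration
with an open left–right crossing of `[0, 2a+1] × [0, 4a+2]` (`a ≥ 1`) lies in `E □ E'` for some
left block event `E` and some right block event `E'`, the disjoint occurrence being witnessed by
the open sites of the two strips `{x₀ ≤ a}` and `{x₀ ≥ a + 1}`. [cite: Nolin2008, §7.4, Lemma 39 (proof, eq. (7.21); arXiv 0711.4948: Lemma 37)] -/
theorem exists_mem_disjointOccurrence_block {a : ℕ} (ha : 1 ≤ a) {ω : SiteConfig (LatticeModels.Site 2)}
    (hω : ω ∈ triLRCrossing (2 * a + 1) (4 * a + 2)) :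
    ∃ b i b' i', ω ∈ blockEventL a b i □ blockEventR a b' i' := by
  obtain ⟨x, hx, y, hy, hxy⟩ := mem_triLRCrossing_iff.1 hω
  have hx0 := (Finset.mem_filter.1 hx).2
  have hy0 := (Finset.mem_filter.1 hy).2
  have hP := PathIn.of_mem_siteConnIn hxy
  have hRb : ∀ z ∈ (↑(rectangle (2 * a + 1) (4 * a + 2)) ∩ ω : Set (LatticeModels.Site 2)),
      (0 : ℤ) ≤ z 0 ∧ z 0 ≤ 2 * a + 1 ∧ (0 : ℤ) ≤ z 1 ∧ z 1 ≤ 4 * a + 2 := fun z hz => by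
    have := mem_rectangle_iff.1 (Finset.mem_coe.1 hz.1); push_cast at this; omega
  -- the two pieces
  obtain ⟨u, v, hu, hv, hL⟩ := hP.exists_slab_crossing 0 (L := 0) (R := a)
    (by positivity) (le_of_eq hx0) (by rw [hy0]; push_cast; omega)
  obtain ⟨u', v', hu', hv', hR⟩ := hP.exists_slab_crossing 0 (L := (a : ℤ) + 1) (R := 2 * a + 1)
    (by omega) (by rw [hx0]; positivity) (by rw [hy0]; push_cast; omega)
  -- the witnesses of disjoint occurrence
  set K : Set (LatticeModels.Site 2) := {z | z ∈ ω ∧ z ∈ (↑(rectangle (2 * a + 1) (4 * a + 2)) : Set (LatticeModels.Site 2)) ∧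
    z 0 ≤ a} with hK
  set L : Set (LatticeModels.Site 2) := {z | z ∈ ω ∧ z ∈ (↑(rectangle (2 * a + 1) (4 * a + 2)) : Set (LatticeModels.Site 2)) ∧
    (a : ℤ) + 1 ≤ z 0} with hL'
  have hKω : K ⊆ ω := fun z hz => hz.1
  have hLω : L ⊆ ω := fun z hz => hz.1
  have hKL : Disjoint K L := Set.disjoint_left.2 fun z hzK hzL => by
    have := hzK.2.2; have := hzL.2.2; omega
  have ha2 : (1 : ℤ) ≤ a := by exact_mod_cast ha
  -- the left piece gives a left block event containing `K`
  have hleft : ∃ b i, K ∈ blockEventL a b i := by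
    have hS : ∀ z ∈ (↑(rectangle (2 * a + 1) (4 * a + 2)) ∩ ω ∩ {z : LatticeModels.Site 2 | (0 : ℤ) ≤ z 0 ∧ z 0 ≤ a}
        : Set (LatticeModels.Site 2)), 0 ≤ z 1 ∧ z 1 ≤ 4 * (a : ℤ) + 2 := fun z hz => ⟨(hRb z hz.1).2.2.1, (hRb z hz.1).2.2.2⟩
    rcases hL.band_or_window ha2 hS with ⟨i, hi3, u'', v'', hu'', hv'', hq⟩ | ⟨j, hj3, hq⟩
    · refine ⟨true, ⟨i, by omega⟩, ?_⟩
      show K ∈ SiteConfig.relabel (triShiftIso (-![(0 : ℤ), ((i : ℕ) : ℤ) * a])).toEquiv ⁻¹'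
        triTBCrossing (2 * a) a
      refine mem_shift_triTBCrossing_of_pathIn (u := u'') (v := v'') (by simp [hu''])
        (by simp [hv'']) (hq.mono fun z hz => ?_)
      have hb := hRb z hz.1.1
      have h2 := hz.1.2; have h3 := hz.2
      simp only [Set.mem_setOf_eq] at h2 h3
      refine ⟨⟨hz.1.1.2, hz.1.1.1, h2.2⟩, ?_⟩
      simp only [Set.mem_setOf_eq, Matrix.cons_val_zero, Matrix.cons_val_one, Matrix.cons_val_fin_one]
      push_cast; omega
    · refine ⟨false, ⟨j, by omega⟩, ?_⟩
      show K ∈ SiteConfig.relabel (triShiftIso (-![(0 : ℤ), ((j : ℕ) : ℤ) * a])).toEquiv ⁻¹'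
        triLRCrossing a (2 * a)
      refine mem_shift_triLRCrossing_of_pathIn (u := u) (v := v) (by simp [hu]) (by simp [hv])
        (hq.mono fun z hz => ?_)
      have hb := hRb z hz.1.1
      have h2 := hz.1.2; have h3 := hz.2
      simp only [Set.mem_setOf_eq] at h2 h3
      refine ⟨⟨hz.1.1.2, hz.1.1.1, h2.2⟩, ?_⟩
      simp only [Set.mem_setOf_eq, Matrix.cons_val_zero, Matrix.cons_val_one, Matrix.cons_val_fin_one]
      push_cast; omega
  -- the right piece gives a right block event containing `L`
  have hright : ∃ b i, L ∈ blockEventR a b i := by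
    have hS : ∀ z ∈ (↑(rectangle (2 * a + 1) (4 * a + 2)) ∩ ω ∩
        {z : LatticeModels.Site 2 | (a : ℤ) + 1 ≤ z 0 ∧ z 0 ≤ 2 * a + 1} : Set (LatticeModels.Site 2)),
        0 ≤ z 1 ∧ z 1 ≤ 4 * (a : ℤ) + 2 := fun z hz => ⟨(hRb z hz.1).2.2.1, (hRb z hz.1).2.2.2⟩
    rcases hR.band_or_window ha2 hS with ⟨i, hi3, u'', v'', hu'', hv'', hq⟩ | ⟨j, hj3, hq⟩
    · refine ⟨true, ⟨i, by omega⟩, ?_⟩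
      show L ∈ SiteConfig.relabel (triShiftIso (-![(1 : ℤ), ((i : ℕ) : ℤ) * a])).toEquiv ⁻¹'
        triTBCrossing (2 * a) a
      refine mem_shift_triTBCrossing_of_pathIn (u := u'') (v := v'') (by simp [hu''])
        (by simp [hv'']) (hq.mono fun z hz => ?_)
      have hb := hRb z hz.1.1
      have h2 := hz.1.2; have h3 := hz.2
      simp only [Set.mem_setOf_eq] at h2 h3
      refine ⟨⟨hz.1.1.2, hz.1.1.1, h2.1⟩, ?_⟩
      simp only [Set.mem_setOf_eq, Matrix.cons_val_zero, Matrix.cons_val_one, Matrix.cons_val_fin_one]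
      push_cast; omega
    · refine ⟨false, ⟨j, by omega⟩, ?_⟩
      show L ∈ SiteConfig.relabel (triShiftIso (-![((a : ℤ) + 1), ((j : ℕ) : ℤ) * a])).toEquiv ⁻¹'
        triLRCrossing a (2 * a)
      refine mem_shift_triLRCrossing_of_pathIn (u := u') (v := v') (by simp [hu'])
        (by simp [hv']; ring) (hq.mono fun z hz => ?_)
      have hb := hRb z hz.1.1
      have h2 := hz.1.2; have h3 := hz.2
      simp only [Set.mem_setOf_eq] at h2 h3
      refine ⟨⟨hz.1.1.2, hz.1.1.1, h2.1⟩, ?_⟩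
      simp only [Set.mem_setOf_eq, Matrix.cons_val_zero, Matrix.cons_val_one, Matrix.cons_val_fin_one]
      push_cast; omega
  obtain ⟨b, i, hKE⟩ := hleft
  obtain ⟨b', i', hLE⟩ := hright
  exact ⟨b, i, b', i', ((isUpperSet_blockEventL a b i).mem_disjointOccurrence_iff
    (isUpperSet_blockEventR a b' i') ω).2 ⟨K, hKω, L, hLω, hKL, hKE, hLE⟩⟩

/-- `LR(2a+1, 4a+2) ⊆ ⋃_{E, E'} E □ E'` over the 100 pairs of block events. [cite: Nolin2008, §7.4, Lemma 39 (proof, eq. (7.21); arXiv 0711.4948: Lemma 37)] -/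
theorem triLRCrossing_subset_iUnion_disjointOccurrence {a : ℕ} (ha : 1 ≤ a) :
    triLRCrossing (2 * a + 1) (4 * a + 2) ⊆
      ⋃ q ∈ (Finset.univ : Finset ((Bool × Fin 5) × (Bool × Fin 5))),
        blockEventL a q.1.1 q.1.2 □ blockEventR a q.2.1 q.2.2 := by
  intro ω hω
  obtain ⟨b, i, b', i', h⟩ := exists_mem_disjointOccurrence_block ha hω
  exact Set.mem_iUnion₂.2 ⟨((b, i), (b', i')), Finset.mem_univ _, h⟩

/-! ### The block inequality (7.21) -/

/-- **The block inequality** (Nolin 2008, §7.4, proof of Lemma 39, eq. (7.21), lattice form for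
site percolation on `𝕋`): for `a ≥ 1` and every `p`,
`P_p(LR(2a+1, 4a+2)) ≤ 100 · P_p(LR(a, 2a))²` — union bound over the 100 pairs of block events and
the BK inequality `P_p(E □ E') ≤ P_p(E) P_p(E')` (`sitePercolation_bk`), each block event having
probability `P_p(LR(a, 2a))`. [cite: Nolin2008, §7.4, Lemma 39 (proof, eq. (7.21); arXiv 0711.4948: Lemma 37)] -/
theorem triLRCrossingProb_block_le (p : unitInterval) {a : ℕ} (ha : 1 ≤ a) :
    triLRCrossingProb p (2 * a + 1) (4 * a + 2) ≤ 100 * triLRCrossingProb p a (2 * a) ^ 2 := by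
  classical
  set μ := LatticeModels.triSitePercolation p with hμ
  have hμ' : μ = sitePercolation (LatticeModels.Site 2) p := rfl
  set q := triLRCrossingProb p a (2 * a) with hq
  -- BK for each pair
  have hpair : ∀ x : (Bool × Fin 5) × (Bool × Fin 5),
      μ.real (blockEventL a x.1.1 x.1.2 □ blockEventR a x.2.1 x.2.2) ≤ q * q := by
    rintro ⟨⟨b, i⟩, ⟨b', i'⟩⟩
    obtain ⟨F, hF⟩ := exists_determinedBy_blockEventL a b i
    obtain ⟨F', hF'⟩ := exists_determinedBy_blockEventR a b' i'
    have h := sitePercolation_bk p (F := F ∪ F') (hF.mono (by simp)) (hF'.mono (by simp))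
      (isUpperSet_blockEventL a b i) (isUpperSet_blockEventR a b' i')
    rw [← hμ'] at h
    simp only at h ⊢
    rwa [real_blockEventL, real_blockEventR] at h
  calc triLRCrossingProb p (2 * a + 1) (4 * a + 2)
        = μ.real (triLRCrossing (2 * a + 1) (4 * a + 2)) := rfl
    _ ≤ μ.real (⋃ x ∈ (Finset.univ : Finset ((Bool × Fin 5) × (Bool × Fin 5))),
          blockEventL a x.1.1 x.1.2 □ blockEventR a x.2.1 x.2.2) :=
        measureReal_mono (triLRCrossing_subset_iUnion_disjointOccurrence ha) (measure_ne_top _ _)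
    _ ≤ ∑ x ∈ (Finset.univ : Finset ((Bool × Fin 5) × (Bool × Fin 5))),
          μ.real (blockEventL a x.1.1 x.1.2 □ blockEventR a x.2.1 x.2.2) :=
        measureReal_biUnion_finset_le _ _
    _ ≤ ∑ _x ∈ (Finset.univ : Finset ((Bool × Fin 5) × (Bool × Fin 5))), q * q :=
        Finset.sum_le_sum fun x _ => hpair x
    _ = 100 * q ^ 2 := by
        rw [Finset.sum_const, Finset.card_univ, nsmul_eq_mul]
        simp only [Fintype.card_prod, Fintype.card_bool, Fintype.card_fin]
        ring

end Literature.Probability.Percolation
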